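import Summits.AtomisticToContinuum.HydrodynamicLimit.Theorems.AnnealedZeroHorizonMeanFluxClosureDeviatoricStressClosureB
import Summits.AtomisticToContinuum.HydrodynamicLimit.Theorems.OneFlightGossipEngineClampedCurrentsDockWindowBalance
import HarnessLib

/-!
# Crux `MeanFluxClosure` (stmt-AtomisticToContinuum-9256), line `registered` — stub KE-b
# (ideal energy-current / heat-flux closure), part 2: integrability at every `N`

Support file (`--supports stmt-AtomisticToContinuum-9256`) for the stub
`stub_idealEnergyCurrentClosure` (KE-b) of the lead's skeleton of
`Summit.AtomisticToContinuum.HydrodynamicLimit.Theses.AnnealedZeroHorizon.MeanFluxClosure`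
(`E[T^e_ψ − J^e_ψ] → 0`: mollified kinetic energy current tested with `∇ψ` minus the ideal enthalpy
flux of the mollified fields). Here the `Integrable` conjunct of the stub is proved AT EVERY `N`
(registered sub-goal `stub_idealEnergyCurrentClosure_integrable`), for `σ ≤ 1/2`, continuous
profiles `a₀, θ₀ > 0`, `u₀`, every flow, window, smooth `ψ` and continuous probability kernel `k ≥ 0`:
* pointwise, both (cubic) integrands are dominated by `K · M(w) · R(w, x)` with the CONSERVED moment
  functional `M(w) = Σ_b‖v_b‖² + (Σ_b‖v_b‖²)²` and the mollified density `R(w, x) = n⁻¹Σ_a k(x − x_a)`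
  (`abs_currentIntegrand_le`, `abs_idealCurrentIntegrand_le`: `‖v_a‖³, (Σ_b‖v_b‖²)‖v_a‖ ≤ M/2`), whence
  `|T^e(w)|, |J^e(w)| ≤ K M(w)` after `∫_x` (`abs_integral_le_of_abs_le_density`);
* `M` has finite mean under the local Gibbs law at fixed `N` (`integrable_moment`: Gaussian fourth
  moments, `integrable_sum_norm_pow_four_localGibbsLaw`; the bound is `N`-dependent — NO uniform mean
  bound is claimed, the cubic moment along the flow being an open `HighMomentumCutoff`-type input);
* window integrals of `M`-dominated measurable observables along the flow are integrable
  (`integrable_window_flow_moment`); the observables are measurable by joint continuity/measurability of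
  the integrands in (configuration, base point) (`measurable_currentObservable`, `measurable_idealCurrentObservable`).

No definitions. References: Spohn, *Large Scale Dynamics of Interacting Particles* (1991), Part I Ch. 3.
-/

noncomputable section

namespace Summit.AtomisticToContinuum.HydrodynamicLimit.Theorems

open scoped BigOperators ENNReal Topology InnerProductSpace
open MeasureTheory Set Filter
open Literature.Analysis.FluidPDE Literature.Analysis.FunctionSpaces
open Literature.MathematicalPhysics.KineticTheory

namespace IdealEnergyCurrentClosure

open DeviatoricStressClosure

/-! ### Pointwise bounds: both integrands are dominated by `M(w) · R(w, x)` -/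

/-- The three partial derivatives of a smooth scalar function are uniformly bounded. [folklore] -/
theorem exists_forall_abs_partialDeriv_le_scalar {ψ : T3 → ℝ} (hψ : Torus.IsSmooth ψ) :
    ∃ C : ℝ, 0 ≤ C ∧ ∀ i x, |Torus.partialDeriv i ψ x| ≤ C := by
  choose C hC0 hC using fun i : Fin 3 =>
    exists_forall_abs_le_of_continuous (hψ.partialDeriv i).continuous
  refine ⟨∑ i, C i, Finset.sum_nonneg fun i _ => hC0 i, fun i x => (hC i x).trans ?_⟩
  exact Finset.single_le_sum (f := C) (fun j _ => hC0 j) (Finset.mem_univ i)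

/-- Pairing a vector of `ℝ³` with a covector bounded by `C`: `|Σ_i V_i ∂_iψ(x)| ≤ 3 C ‖V‖`. [folklore] -/
theorem abs_sum_mul_partialDeriv_le (V : V3) {ψ : T3 → ℝ} {C : ℝ}
    (hC : ∀ i y, |Torus.partialDeriv i ψ y| ≤ C) (x : T3) :
    |∑ i, V i * Torus.partialDeriv i ψ x| ≤ 3 * C * ‖V‖ := by
  have hvi : ∀ l, |V l| ≤ ‖V‖ := fun l => (Real.norm_eq_abs _).symm.trans_le (PiLp.norm_apply_le V l)
  calc |∑ i, V i * Torus.partialDeriv i ψ x| ≤ ∑ i, |V i * Torus.partialDeriv i ψ x| :=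
        Finset.abs_sum_le_sum_abs _ _
    _ ≤ ∑ _i : Fin 3, ‖V‖ * C := Finset.sum_le_sum fun i _ => by
        rw [abs_mul]
        exact mul_le_mul (hvi i) (hC i x) (abs_nonneg _) (norm_nonneg _)
    _ = 3 * C * ‖V‖ := by
        simp only [Finset.sum_const, Finset.card_univ, Fintype.card_fin]
        ring

/-- Each velocity is controlled by the moment functional `M = Σ_b‖v_b‖² + (Σ_b‖v_b‖²)²`:
`‖v_a‖³ ≤ M/2` and `(Σ_b‖v_b‖²)‖v_a‖ ≤ M/2` (`t ≤ (1 + t²)/2`, `‖v_a‖² ≤ Σ_b‖v_b‖²`). [folklore] -/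
theorem norm_pow_three_le_and_energy_mul_norm_le {n : ℕ} (w : Config n (Fin 3) T3) (a : Fin n) :
    ‖(w a).2‖ ^ 3 ≤ ((∑ b, ‖(w b).2‖ ^ 2) + (∑ b, ‖(w b).2‖ ^ 2) ^ 2) / 2 ∧
      (∑ b, ‖(w b).2‖ ^ 2) * ‖(w a).2‖ ≤ ((∑ b, ‖(w b).2‖ ^ 2) + (∑ b, ‖(w b).2‖ ^ 2) ^ 2) / 2 := by
  set t : ℝ := ‖(w a).2‖ with ht
  set E : ℝ := ∑ b, ‖(w b).2‖ ^ 2 with hE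
  have ht0 : 0 ≤ t := norm_nonneg _
  have htE : t ^ 2 ≤ E :=
    Finset.single_le_sum (f := fun b => ‖(w b).2‖ ^ 2) (fun _ _ => sq_nonneg _) (Finset.mem_univ a)
  have hE0 : 0 ≤ E := (sq_nonneg t).trans htE
  have h1 : t ≤ (1 + E) / 2 := by nlinarith [sq_nonneg (t - 1)]
  have h2 : E * t ≤ (E + E ^ 2) / 2 := by nlinarith [mul_le_mul_of_nonneg_left h1 hE0]
  refine ⟨?_, h2⟩
  calc t ^ 3 = t * t ^ 2 := by ring
    _ ≤ t * E := mul_le_mul_of_nonneg_left htE ht0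
    _ ≤ (E + E ^ 2) / 2 := by rw [mul_comm]; exact h2

/-- **Bound on the mollified kinetic energy current tested with `∇ψ`:**
`|c Σ_a k_a (v_a·∇ψ) ‖v_a‖²/2| ≤ (¾ C M(w)) · c Σ_a k_a` (`|∂_iψ| ≤ C`, `k ≥ 0`, `c ≥ 0`). [folklore] -/
theorem abs_currentIntegrand_le {n : ℕ} (w : Config n (Fin 3) T3) (x : T3) {k : T3 → ℝ}
    (hk0 : ∀ y, 0 ≤ k y) {ψ : T3 → ℝ} {C : ℝ} (hC : ∀ i y, |Torus.partialDeriv i ψ y| ≤ C)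
    {c : ℝ} (hc : 0 ≤ c) :
    |c * ∑ a, k (x - (w a).1) * ((∑ i, (w a).2 i * Torus.partialDeriv i ψ x) * (‖(w a).2‖ ^ 2 / 2))| ≤
      3 / 4 * C * ((∑ b, ‖(w b).2‖ ^ 2) + (∑ b, ‖(w b).2‖ ^ 2) ^ 2) * (c * ∑ a, k (x - (w a).1)) := by
  set M : ℝ := (∑ b, ‖(w b).2‖ ^ 2) + (∑ b, ‖(w b).2‖ ^ 2) ^ 2 with hM
  have hC0 : 0 ≤ C := (abs_nonneg _).trans (hC 0 x)
  have hkey : ∀ a, |k (x - (w a).1) * ((∑ i, (w a).2 i * Torus.partialDeriv i ψ x) * (‖(w a).2‖ ^ 2 / 2))| ≤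
      3 / 4 * C * M * k (x - (w a).1) := fun a => by
    rw [abs_mul, abs_of_nonneg (hk0 _), abs_mul, abs_of_nonneg (by positivity : 0 ≤ ‖(w a).2‖ ^ 2 / 2),
      mul_comm (3 / 4 * C * M)]
    refine mul_le_mul_of_nonneg_left ?_ (hk0 _)
    calc |∑ i, (w a).2 i * Torus.partialDeriv i ψ x| * (‖(w a).2‖ ^ 2 / 2)
        ≤ 3 * C * ‖(w a).2‖ * (‖(w a).2‖ ^ 2 / 2) :=
          mul_le_mul_of_nonneg_right (abs_sum_mul_partialDeriv_le (w a).2 hC x) (by positivity)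
      _ = 3 / 2 * C * ‖(w a).2‖ ^ 3 := by ring
      _ ≤ 3 / 2 * C * (M / 2) :=
          mul_le_mul_of_nonneg_left (norm_pow_three_le_and_energy_mul_norm_le w a).1 (by positivity)
      _ = 3 / 4 * C * M := by ring
  rw [abs_mul, abs_of_nonneg hc, mul_left_comm, Finset.mul_sum]
  exact mul_le_mul_of_nonneg_left ((Finset.abs_sum_le_sum_abs _ _).trans (Finset.sum_le_sum fun a _ => hkey a)) hc

/-- The mollified momentum is dominated by the mollified speed: `‖Mv‖ ≤ n⁻¹ Σ_a k_a ‖v_a‖`. [folklore] -/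
theorem norm_mollifiedMomentum_le {n : ℕ} (w : Config n (Fin 3) T3) (x : T3) {k : T3 → ℝ}
    (hk0 : ∀ y, 0 ≤ k y) {Mv : V3} (hMv : Mv = empiricalMomentumField w (fun y => k (x - y))) :
    ‖Mv‖ ≤ (n : ℝ)⁻¹ * ∑ a, k (x - (w a).1) * ‖(w a).2‖ := by
  have hc0 : 0 ≤ (n : ℝ)⁻¹ := inv_nonneg.2 (Nat.cast_nonneg n)
  rw [hMv, empiricalMomentumField_eq_sum, norm_smul, Real.norm_eq_abs, abs_of_nonneg hc0]
  refine mul_le_mul_of_nonneg_left ((norm_sum_le _ _).trans (Finset.sum_le_sum fun a _ => ?_)) hc0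
  rw [norm_smul, Real.norm_eq_abs, abs_of_nonneg (hk0 _)]

/-- The mollified internal energy per mollified mass is at most half the total kinetic energy:
`En/R ≤ ½ Σ_b‖v_b‖²` (a weighted average of the `‖v_a‖²/2`; `0` at `R = 0`). [folklore] -/
theorem energy_div_density_le {n : ℕ} (w : Config n (Fin 3) T3) (x : T3) {k : T3 → ℝ}
    (hk0 : ∀ y, 0 ≤ k y) {R En : ℝ} (hR : R = empiricalDensityField w (fun y => k (x - y)))
    (hEn : En = empiricalEnergyField w (fun y => k (x - y))) :
    En / R ≤ (∑ b, ‖(w b).2‖ ^ 2) / 2 := by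
  have hc0 : 0 ≤ (n : ℝ)⁻¹ := inv_nonneg.2 (Nat.cast_nonneg n)
  have hE0 : 0 ≤ ∑ b, ‖(w b).2‖ ^ 2 := Finset.sum_nonneg fun b _ => sq_nonneg _
  have hRs : R = (n : ℝ)⁻¹ * ∑ a, k (x - (w a).1) := by rw [hR, empiricalDensityField_eq_sum]
  have hR0 : 0 ≤ R := by
    rw [hRs]
    exact mul_nonneg hc0 (Finset.sum_nonneg fun a _ => hk0 _)
  have hle : En ≤ R * ((∑ b, ‖(w b).2‖ ^ 2) / 2) := by
    rw [hEn, empiricalEnergyField_eq_sum, hRs, mul_assoc, Finset.sum_mul]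
    refine mul_le_mul_of_nonneg_left (Finset.sum_le_sum fun a _ => mul_le_mul_of_nonneg_left ?_ (hk0 _)) hc0
    exact div_le_div_of_nonneg_right (Finset.single_le_sum (f := fun b => ‖(w b).2‖ ^ 2)
      (fun _ _ => sq_nonneg _) (Finset.mem_univ a)) zero_le_two
  rcases hR0.eq_or_lt with h | h
  · rw [← h, div_zero]
    positivity
  · rwa [div_le_iff₀' h]

/-- **Bound on the ideal enthalpy flux of the mollified fields tested with `∇ψ`:**
`|((En + RΘ)/R)(Mv·∇ψ)| ≤ (5/4 · C · M(w)) · n⁻¹Σ_a k_a` (`|En + RΘ| ≤ 5En/3`, `En/R ≤ ½Σ‖v_b‖²`,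
`‖Mv‖ ≤ n⁻¹Σ k_a‖v_a‖`, `(Σ_b‖v_b‖²)‖v_a‖ ≤ M/2`; everything is `0` at `R = 0`). [folklore] -/
theorem abs_idealCurrentIntegrand_le {n : ℕ} (w : Config n (Fin 3) T3) (x : T3) {k : T3 → ℝ}
    (hk0 : ∀ y, 0 ≤ k y) {ψ : T3 → ℝ} {C : ℝ} (hC : ∀ i y, |Torus.partialDeriv i ψ y| ≤ C)
    {R En : ℝ} {Mv : V3} (hR : R = empiricalDensityField w (fun y => k (x - y)))
    (hMv : Mv = empiricalMomentumField w (fun y => k (x - y)))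
    (hEn : En = empiricalEnergyField w (fun y => k (x - y))) :
    |(En + R * (2 / 3 * (En / R - ‖Mv‖ ^ 2 / (2 * R ^ 2)))) / R * (∑ i, Mv i * Torus.partialDeriv i ψ x)| ≤
      5 / 4 * C * ((∑ b, ‖(w b).2‖ ^ 2) + (∑ b, ‖(w b).2‖ ^ 2) ^ 2) * ((n : ℝ)⁻¹ * ∑ a, k (x - (w a).1)) := by
  set M : ℝ := (∑ b, ‖(w b).2‖ ^ 2) + (∑ b, ‖(w b).2‖ ^ 2) ^ 2 with hM
  set E : ℝ := ∑ b, ‖(w b).2‖ ^ 2 with hE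
  obtain ⟨hR0, hEn0, -, hP⟩ := abs_reynolds_le_and_abs_pressure_le w x hk0 hR hMv hEn
  have hC0 : 0 ≤ C := (abs_nonneg _).trans (hC 0 x)
  have hc0 : 0 ≤ (n : ℝ)⁻¹ := inv_nonneg.2 (Nat.cast_nonneg n)
  have hE0 : 0 ≤ E := Finset.sum_nonneg fun b _ => sq_nonneg _
  have hER := energy_div_density_le w x hk0 hR hEn
  -- the enthalpy per mass
  have h1 : |(En + R * (2 / 3 * (En / R - ‖Mv‖ ^ 2 / (2 * R ^ 2)))) / R| ≤ 5 / 3 * (E / 2) := by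
    rw [abs_div, abs_of_nonneg hR0]
    have h : |En + R * (2 / 3 * (En / R - ‖Mv‖ ^ 2 / (2 * R ^ 2)))| ≤ 5 / 3 * En := by
      refine (abs_add_le _ _).trans ?_
      rw [abs_of_nonneg hEn0]
      linarith
    calc _ ≤ 5 / 3 * En / R := div_le_div_of_nonneg_right h hR0
      _ = 5 / 3 * (En / R) := by ring
      _ ≤ 5 / 3 * (E / 2) := by linarith
  -- the momentum pairing
  have h2 : |∑ i, Mv i * Torus.partialDeriv i ψ x| ≤ 3 * C * ((n : ℝ)⁻¹ * ∑ a, k (x - (w a).1) * ‖(w a).2‖) :=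
    (abs_sum_mul_partialDeriv_le Mv hC x).trans
      (mul_le_mul_of_nonneg_left (norm_mollifiedMomentum_le w x hk0 hMv) (by positivity))
  have h3 : E * ((n : ℝ)⁻¹ * ∑ a, k (x - (w a).1) * ‖(w a).2‖) ≤ M / 2 * ((n : ℝ)⁻¹ * ∑ a, k (x - (w a).1)) := by
    rw [mul_left_comm, mul_left_comm (M / 2), Finset.mul_sum, Finset.mul_sum, Finset.mul_sum, Finset.mul_sum]
    refine Finset.sum_le_sum fun a _ => ?_
    calc (n : ℝ)⁻¹ * (E * (k (x - (w a).1) * ‖(w a).2‖)) = (n : ℝ)⁻¹ * (k (x - (w a).1) * (E * ‖(w a).2‖)) := by ring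
      _ ≤ (n : ℝ)⁻¹ * (k (x - (w a).1) * (M / 2)) := mul_le_mul_of_nonneg_left (mul_le_mul_of_nonneg_left
            (norm_pow_three_le_and_energy_mul_norm_le w a).2 (hk0 _)) hc0
      _ = (n : ℝ)⁻¹ * (M / 2 * k (x - (w a).1)) := by ring
  rw [abs_mul]
  calc |(En + R * (2 / 3 * (En / R - ‖Mv‖ ^ 2 / (2 * R ^ 2)))) / R| * |∑ i, Mv i * Torus.partialDeriv i ψ x|
      ≤ 5 / 3 * (E / 2) * (3 * C * ((n : ℝ)⁻¹ * ∑ a, k (x - (w a).1) * ‖(w a).2‖)) :=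
        mul_le_mul h1 h2 (abs_nonneg _) (by positivity)
    _ = 5 / 2 * C * (E * ((n : ℝ)⁻¹ * ∑ a, k (x - (w a).1) * ‖(w a).2‖)) := by ring
    _ ≤ 5 / 2 * C * (M / 2 * ((n : ℝ)⁻¹ * ∑ a, k (x - (w a).1))) := mul_le_mul_of_nonneg_left h3 (by positivity)
    _ = 5 / 4 * C * M * ((n : ℝ)⁻¹ * ∑ a, k (x - (w a).1)) := by ring

/-! ### Space integrals: the two observables are dominated by `M(w)` -/

/-- If `|F(x)| ≤ A · n⁻¹Σ_a k(x − x_a)` for a continuous kernel of mass one and `A ≥ 0`, then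
`|∫_x F| ≤ A` (`∫_x n⁻¹Σ_a k(x − x_a) dx = n⁻¹ · n ≤ 1`). [folklore] -/
theorem abs_integral_le_of_abs_le_density {n : ℕ} (w : Config n (Fin 3) T3) {k : T3 → ℝ}
    (hkc : Continuous k) (hk1 : ∫ y, k y = 1) {F : T3 → ℝ} {A : ℝ} (hA : 0 ≤ A)
    (hF : ∀ x, |F x| ≤ A * ((n : ℝ)⁻¹ * ∑ a, k (x - (w a).1))) : |∫ x, F x| ≤ A := by
  have hg : Integrable (fun x => A * ((n : ℝ)⁻¹ * ∑ a, k (x - (w a).1))) :=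
    integrable_of_continuous_T3 (continuous_const.mul (continuous_const.mul
      (continuous_finsetSum _ fun a _ => hkc.comp (continuous_id.sub continuous_const))))
  rw [← Real.norm_eq_abs]
  refine (norm_integral_le_of_norm_le hg (ae_of_all _ fun x => ?_)).trans ?_
  · rw [Real.norm_eq_abs]
    exact hF x
  · have h1 : ∫ x, (n : ℝ)⁻¹ * ∑ a, k (x - (w a).1) = (n : ℝ)⁻¹ * ∑ _a : Fin n, (1 : ℝ) := by
      simpa only [mul_one] using integral_avg_kernel_mul w hkc hk1 (n : ℝ)⁻¹ (fun _ => 1)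
    have h2 : (n : ℝ)⁻¹ * ∑ _a : Fin n, (1 : ℝ) ≤ 1 := by
      simp only [Finset.sum_const, Finset.card_univ, Fintype.card_fin, nsmul_eq_mul, mul_one]
      exact inv_mul_le_one
    rw [integral_const_mul, h1]
    exact (mul_le_mul_of_nonneg_left h2 hA).trans_eq (mul_one A)

/-- **The mollified energy-current observable is dominated by the moment functional:**
`|∫_x n⁻¹Σ_a k(x−x_a)(v_a·∇ψ)‖v_a‖²/2 dx| ≤ ¾ C M(w)`. [folklore] -/
theorem abs_integral_currentIntegrand_le {n : ℕ} (w : Config n (Fin 3) T3) {k : T3 → ℝ}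
    (hkc : Continuous k) (hk0 : ∀ y, 0 ≤ k y) (hk1 : ∫ y, k y = 1) {ψ : T3 → ℝ} {C : ℝ}
    (hC : ∀ i y, |Torus.partialDeriv i ψ y| ≤ C) :
    |∫ x, (n : ℝ)⁻¹ * ∑ a, k (x - (w a).1) * ((∑ i, (w a).2 i * Torus.partialDeriv i ψ x) * (‖(w a).2‖ ^ 2 / 2))| ≤
      3 / 4 * C * ((∑ b, ‖(w b).2‖ ^ 2) + (∑ b, ‖(w b).2‖ ^ 2) ^ 2) := by
  have hC0 : 0 ≤ C := (abs_nonneg _).trans (hC 0 0)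
  exact abs_integral_le_of_abs_le_density w hkc hk1 (by positivity)
    fun x => abs_currentIntegrand_le w x hk0 hC (inv_nonneg.2 (Nat.cast_nonneg n))

/-- **The ideal enthalpy-flux observable is dominated by the moment functional:**
`|∫_x ((En + RΘ)/R)(Mv·∇ψ) dx| ≤ 5/4 C M(w)`. [folklore] -/
theorem abs_integral_idealCurrentIntegrand_le {n : ℕ} (w : Config n (Fin 3) T3) {k : T3 → ℝ}
    (hkc : Continuous k) (hk0 : ∀ y, 0 ≤ k y) (hk1 : ∫ y, k y = 1) {ψ : T3 → ℝ} {C : ℝ}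
    (hC : ∀ i y, |Torus.partialDeriv i ψ y| ≤ C) :
    |∫ x, (empiricalEnergyField w (fun y => k (x - y)) + empiricalDensityField w (fun y => k (x - y)) *
        (2 / 3 * (empiricalEnergyField w (fun y => k (x - y)) / empiricalDensityField w (fun y => k (x - y)) -
          ‖empiricalMomentumField w (fun y => k (x - y))‖ ^ 2 / (2 * empiricalDensityField w (fun y => k (x - y)) ^ 2)))) /
        empiricalDensityField w (fun y => k (x - y)) *
      (∑ i, empiricalMomentumField w (fun y => k (x - y)) i * Torus.partialDeriv i ψ x)| ≤
      5 / 4 * C * ((∑ b, ‖(w b).2‖ ^ 2) + (∑ b, ‖(w b).2‖ ^ 2) ^ 2) := by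
  have hC0 : 0 ≤ C := (abs_nonneg _).trans (hC 0 0)
  exact abs_integral_le_of_abs_le_density w hkc hk1 (by positivity)
    fun x => abs_idealCurrentIntegrand_le w x hk0 hC rfl rfl rfl

/-! ### Measurability of the two observables -/

/-- The mollified energy-current integrand is jointly continuous in (configuration, base point). [folklore] -/
theorem continuous_currentIntegrand_prod {n : ℕ} {k : T3 → ℝ} (hkc : Continuous k) {ψ : T3 → ℝ}
    (hψ : Torus.IsSmooth ψ) (c : ℝ) :
    Continuous fun p : Config n (Fin 3) T3 × T3 => c * ∑ a, k (p.2 - (p.1 a).1) *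
      ((∑ i, (p.1 a).2 i * Torus.partialDeriv i ψ p.2) * (‖(p.1 a).2‖ ^ 2 / 2)) := by
  have hv : ∀ a : Fin n, Continuous fun p : Config n (Fin 3) T3 × T3 => (p.1 a).2 := fun a => by fun_prop
  refine continuous_const.mul (continuous_finsetSum _ fun a _ => ?_)
  refine (hkc.comp (by fun_prop)).mul ((continuous_finsetSum _ fun i _ => ?_).mul (((hv a).norm.pow 2).div_const 2))
  exact ((PiLp.continuous_apply 2 _ i).comp (hv a)).mul ((hψ.partialDeriv i).continuous.comp continuous_snd)

/-- **The mollified energy-current observable is measurable** in the configuration. [folklore] -/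
theorem measurable_currentObservable {n : ℕ} {k : T3 → ℝ} (hkc : Continuous k) {ψ : T3 → ℝ}
    (hψ : Torus.IsSmooth ψ) (c : ℝ) :
    Measurable fun w : Config n (Fin 3) T3 => ∫ x, c * ∑ a, k (x - (w a).1) *
      ((∑ i, (w a).2 i * Torus.partialDeriv i ψ x) * (‖(w a).2‖ ^ 2 / 2)) := by
  haveI : OpensMeasurableSpace (Config n (Fin 3) T3 × T3) := Prod.opensMeasurableSpace
  exact ((continuous_currentIntegrand_prod (n := n) hkc hψ c).measurable.stronglyMeasurable.integral_prod_right'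
    (ν := (volume : Measure T3))).measurable

/-- **The ideal enthalpy-flux integrand is jointly measurable** in (configuration, base point): the
mollified fields are continuous in `(w, x)` and division is measurable. [folklore] -/
theorem measurable_idealCurrentIntegrand {n : ℕ} {k : T3 → ℝ} (hkc : Continuous k) {ψ : T3 → ℝ}
    (hψ : Torus.IsSmooth ψ) :
    Measurable fun p : Config n (Fin 3) T3 × T3 =>
      (empiricalEnergyField p.1 (fun y => k (p.2 - y)) + empiricalDensityField p.1 (fun y => k (p.2 - y)) *
          (2 / 3 * (empiricalEnergyField p.1 (fun y => k (p.2 - y)) / empiricalDensityField p.1 (fun y => k (p.2 - y)) -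
            ‖empiricalMomentumField p.1 (fun y => k (p.2 - y))‖ ^ 2 /
              (2 * empiricalDensityField p.1 (fun y => k (p.2 - y)) ^ 2)))) /
          empiricalDensityField p.1 (fun y => k (p.2 - y)) *
        (∑ i, empiricalMomentumField p.1 (fun y => k (p.2 - y)) i * Torus.partialDeriv i ψ p.2) := by
  haveI : OpensMeasurableSpace (Config n (Fin 3) T3 × T3) := Prod.opensMeasurableSpace
  have mR := (continuous_density_prod (n := n) hkc).measurable
  have hMv := continuous_momentum_prod (n := n) hkc
  have mMv : ∀ l, Measurable fun p : Config n (Fin 3) T3 × T3 => empiricalMomentumField p.1 (fun y => k (p.2 - y)) l :=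
    fun l => ((PiLp.continuous_apply 2 _ l).comp hMv).measurable
  have mN := (continuous_norm.comp hMv).measurable
  have mEn := (continuous_energy_prod (n := n) hkc).measurable
  have mP : ∀ i, Measurable fun p : Config n (Fin 3) T3 × T3 => Torus.partialDeriv i ψ p.2 :=
    fun i => ((hψ.partialDeriv i).continuous.comp continuous_snd).measurable
  exact ((mEn.add (mR.mul (measurable_const.mul ((mEn.div mR).sub ((mN.pow_const 2).div
    (measurable_const.mul (mR.pow_const 2))))))).div mR).mul (Finset.measurable_sum _ fun i _ => (mMv i).mul (mP i))

/-- **The ideal enthalpy-flux observable is measurable** in the configuration (parametric integral of a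
jointly measurable integrand, `StronglyMeasurable.integral_prod_right'`). [folklore] -/
theorem measurable_idealCurrentObservable {n : ℕ} {k : T3 → ℝ} (hkc : Continuous k) {ψ : T3 → ℝ}
    (hψ : Torus.IsSmooth ψ) :
    Measurable fun w : Config n (Fin 3) T3 => ∫ x,
      (empiricalEnergyField w (fun y => k (x - y)) + empiricalDensityField w (fun y => k (x - y)) *
          (2 / 3 * (empiricalEnergyField w (fun y => k (x - y)) / empiricalDensityField w (fun y => k (x - y)) -
            ‖empiricalMomentumField w (fun y => k (x - y))‖ ^ 2 / (2 * empiricalDensityField w (fun y => k (x - y)) ^ 2)))) /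
          empiricalDensityField w (fun y => k (x - y)) *
        (∑ i, empiricalMomentumField w (fun y => k (x - y)) i * Torus.partialDeriv i ψ x) :=
  ((measurable_idealCurrentIntegrand hkc hψ).stronglyMeasurable.integral_prod_right'
    (ν := (volume : Measure T3))).measurable

/-! ### The local Gibbs law: the moment functional and window integrals along the flow -/

/-- **The moment functional `M = Σ_b‖v_b‖² + (Σ_b‖v_b‖²)²` is integrable under the local Gibbs law** at
fixed `N` (`σ ≤ 1/2`, continuous profiles, `a₀, θ₀ > 0`): Gaussian second and fourth moments
(`integrable_energy`, `integrable_sum_norm_pow_four_localGibbsLaw`, `(Σ_b a_b)² ≤ (N+1)Σ_b a_b²`). [folklore] -/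
theorem integrable_moment {σ : ℝ} (hσ : σ ≤ 1 / 2) {a₀ θ₀ : T3 → ℝ} {u₀ : T3 → V3}
    (ha : Continuous a₀) (hθ : Continuous θ₀) (hu : Continuous u₀) (ha0 : ∀ x, 0 < a₀ x)
    (hθ0 : ∀ x, 0 < θ₀ x) (N : ℕ) (Φ : HardSphereFlow (Torus.geometry (Fin 3)) (hsDiameter σ N) (N + 1)) :
    Integrable (fun z : Config (N + 1) (Fin 3) T3 => (∑ b, ‖(z b).2‖ ^ 2) + (∑ b, ‖(z b).2‖ ^ 2) ^ 2)
      (localGibbsLaw σ a₀ u₀ θ₀ N Φ) := by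
  have hn : ((N + 1 : ℕ) : ℝ) ≠ 0 := by positivity
  have hE : Integrable (fun z : Config (N + 1) (Fin 3) T3 => ∑ b, ‖(z b).2‖ ^ 2) (localGibbsLaw σ a₀ u₀ θ₀ N Φ) := by
    refine ((integrable_energy hσ ha hθ hu ha0 hθ0 N Φ).const_mul ((N + 1 : ℕ) : ℝ)).congr (ae_of_all _ fun z => ?_)
    simp only
    rw [← mul_assoc, mul_inv_cancel₀ hn, one_mul]
  have h4 := ClampedCurrentsDockWindowBalance.integrable_sum_norm_pow_four_localGibbsLaw ha hθ hu
    (fun x => (ha0 x).le) hθ0 σ N Φ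
  have hm2 : Measurable fun z : Config (N + 1) (Fin 3) T3 => (∑ b, ‖(z b).2‖ ^ 2) ^ 2 :=
    (Finset.measurable_sum _ fun b _ => ((measurable_pi_apply b).snd).norm.pow_const 2).pow_const 2
  refine hE.add (Integrable.mono' (h4.const_mul ((N + 1 : ℕ) : ℝ)) hm2.aestronglyMeasurable (ae_of_all _ fun z => ?_))
  rw [Real.norm_eq_abs, abs_of_nonneg (sq_nonneg _)]
  calc (∑ b, ‖(z b).2‖ ^ 2) ^ 2 ≤ (Finset.univ.card : ℝ) * ∑ b, (‖(z b).2‖ ^ 2) ^ 2 := sq_sum_le_card_mul_sum_sq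
    _ = ((N + 1 : ℕ) : ℝ) * ∑ b, ‖(z b).2‖ ^ 4 := by
        rw [Finset.card_univ, Fintype.card_fin]
        exact congrArg _ (Finset.sum_congr rfl fun b _ => by ring)

/-- **Window integrals of moment-dominated observables along the flow are integrable** under the local
Gibbs law at fixed `N`: for measurable `G` with `|G(w)| ≤ K M(w)`, `M(w) = Σ_b‖v_b‖² + (Σ_b‖v_b‖²)²`
(conserved by the flow, `sum_norm_sq_vel_flow`), `z ↦ ∫_{t₁}^{t₂} G(Φ_s z) ds` is a.e.-measurable
(`HardSphereFlow.aemeasurable_intervalIntegral_comp_flow_torus`) and bounded by `K |t₂ − t₁| M(z)` on the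
good set. [folklore] -/
theorem integrable_window_flow_moment {σ : ℝ} (hσ : σ ≤ 1 / 2) {a₀ θ₀ : T3 → ℝ} {u₀ : T3 → V3}
    (ha : Continuous a₀) (hθ : Continuous θ₀) (hu : Continuous u₀) (ha0 : ∀ x, 0 < a₀ x)
    (hθ0 : ∀ x, 0 < θ₀ x) {N : ℕ} (Φ : HardSphereFlow (Torus.geometry (Fin 3)) (hsDiameter σ N) (N + 1))
    {G : Config (N + 1) (Fin 3) T3 → ℝ} (hGm : Measurable G) {K : ℝ}
    (hGle : ∀ w, |G w| ≤ K * ((∑ b, ‖(w b).2‖ ^ 2) + (∑ b, ‖(w b).2‖ ^ 2) ^ 2)) (t₁ t₂ : ℝ) :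
    Integrable (fun z => ∫ s in t₁..t₂, G (Φ.flow s z)) (localGibbsLaw σ a₀ u₀ θ₀ N Φ) := by
  obtain ⟨hgood, hgood'⟩ := ae_mem_good_localGibbsLaw σ a₀ u₀ θ₀ N Φ
  refine Integrable.mono' (((integrable_moment hσ ha hθ hu ha0 hθ0 N Φ).const_mul K).mul_const |t₂ - t₁|)
    (Φ.aemeasurable_intervalIntegral_comp_flow_torus hGm t₁ t₂ hgood').aestronglyMeasurable ?_
  filter_upwards [hgood] with z hz
  exact intervalIntegral.norm_integral_le_of_norm_le_const fun s _ => by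
    rw [Real.norm_eq_abs, ← sum_norm_sq_vel_flow Φ hz s]
    exact hGle _

end IdealEnergyCurrentClosure

open IdealEnergyCurrentClosure DeviatoricStressClosure in
/-- **Registered sub-goal `stub_idealEnergyCurrentClosure_integrable` of stub KE-b: the integrability
conjunct at every `N`.** For `σ ≤ 1/2`, continuous profiles `a₀ > 0`, `θ₀ > 0`, `u₀`, every `N`, every
hard-sphere flow `Φ`, every window `t₁, t₂`, every smooth scalar `ψ` and every continuous probability
kernel `k ≥ 0`, the stub's functional `D(z) = ∫_{t₁}^{t₂}∫_x (N+1)⁻¹Σ_a k(x−x_a(s))(v_a(s)·∇ψ(x))‖v_a(s)‖²/2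
− ∫_{t₁}^{t₂}∫_x ((En + RΘ)/R)(Mv·∇ψ)` (as in `stub_idealEnergyCurrentClosure` with `Φ` for `Φ N` —
definitionally the stub's `D`, whose first conjunct is therefore closed by
`exact stub_idealEnergyCurrentClosure_integrable σ hσ.le a₀ θ₀ u₀ ha hθ hu ha0 hθ0 N (Φ N) t₁ t₂ ψ hψ k
hk.1 hk.2.1 hk.2.2.1 D hD`) is integrable under `localGibbsLaw σ a₀ u₀ θ₀ N Φ`. Proof: both window
functionals are integrable (`integrable_window_flow_moment`): the observables are measurable
(`measurable_currentObservable`, `measurable_idealCurrentObservable`) and dominated by `¾C` resp. `5/4 C`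
times the conserved moment functional `M = Σ_b‖v_b‖² + (Σ_b‖v_b‖²)²` (`abs_integral_currentIntegrand_le`,
`abs_integral_idealCurrentIntegrand_le`), of finite mean at fixed `N` (`integrable_moment`). The mean
bound so obtained grows with `N` (cubic velocity moment along the flow): NO uniform bound is claimed —
the content of stub KE-b is the smallness of the mean (`stub_idealEnergyCurrentClosure_identity`). [folklore] -/
theorem stub_idealEnergyCurrentClosure_integrable : ∀ (σ : ℝ), σ ≤ 1 / 2 → ∀ (a₀ θ₀ : Literature.MathematicalPhysics.KineticTheory.T3 → ℝ) (u₀ : Literature.MathematicalPhysics.KineticTheory.T3 → Literature.MathematicalPhysics.KineticTheory.V3), Continuous a₀ → Continuous θ₀ → Continuous u₀ → (∀ x, 0 < a₀ x) → (∀ x, 0 < θ₀ x) → ∀ (N : ℕ) (Φ : Literature.Analysis.FluidPDE.HardSphereFlow (Literature.Analysis.FluidPDE.Torus.geometry (Fin 3)) (Literature.MathematicalPhysics.KineticTheory.hsDiameter σ N) (N + 1)) (t₁ t₂ : ℝ) (ψ : Literature.MathematicalPhysics.KineticTheory.T3 → ℝ), Literature.Analysis.FunctionSpaces.Torus.IsSmooth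 ψ → ∀ (k : Literature.MathematicalPhysics.KineticTheory.T3 → ℝ), Continuous k → (∀ y, 0 ≤ k y) → (∫ y, k y = 1) → ∀ D : Literature.Analysis.FluidPDE.Config (N + 1) (Fin 3) Literature.MathematicalPhysics.KineticTheory.T3 → ℝ, D = (fun z => (∫ s in t₁..t₂, ∫ x, ((N + 1 : ℕ) : ℝ)⁻¹ * ∑ a, k (x - (Φ.flow s z a).1) * ((∑ i, (Φ.flow s z a).2 i * Literature.Analysis.FunctionSpaces.Torus.partialDeriv i ψ x) * (‖(Φ.flow s z a).2‖ ^ 2 / 2))) - (∫ s in t₁..t₂, ∫ x, (((Literature.MathematicalPhysics.KineticTheory.empiricalEnergyField (Φ.flow s z) (fun y => k (x - y)) + Literature.MathematicalPhysics.KineticTheory.empiricalDensityField (Φ.flow s z) (fun y => k (x - y)) * (2 / 3 * (Literature.MathematicalPhysics.KineticTheory.empiricalEnergyField (Φ.flow s z) (fun y => k (x - y)) / Literature.MathematicalPhysics.KineticTheory.empiricalDensityField (Φ.flow s z) (fun y => k (x - y)) - ‖Literature.MathematicalPhysics.KineticTheory.empiricalMomentumField (Φ.flow s z) (fun y => k (x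 - y))‖ ^ 2 / (2 * Literature.MathematicalPhysics.KineticTheory.empiricalDensityField (Φ.flow s z) (fun y => k (x - y)) ^ 2)))) / Literature.MathematicalPhysics.KineticTheory.empiricalDensityField (Φ.flow s z) (fun y => k (x - y))) * (∑ i, Literature.MathematicalPhysics.KineticTheory.empiricalMomentumField (Φ.flow s z) (fun y => k (x - y)) i * Literature.Analysis.FunctionSpaces.Torus.partialDeriv i ψ x)))) → MeasureTheory.Integrable D (Literature.MathematicalPhysics.KineticTheory.localGibbsLaw σ a₀ u₀ θ₀ N Φ) := by
  intro σ hσ a₀ θ₀ u₀ ha hθ hu ha0 hθ0 N Φ t₁ t₂ ψ hψ k hkc hk0 hk1 D hD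
  obtain ⟨C, -, hC⟩ := exists_forall_abs_partialDeriv_le_scalar hψ
  -- the two observables
  set T : Config (N + 1) (Fin 3) T3 → ℝ := fun w => ∫ x, ((N + 1 : ℕ) : ℝ)⁻¹ * ∑ a, k (x - (w a).1) *
    ((∑ i, (w a).2 i * Torus.partialDeriv i ψ x) * (‖(w a).2‖ ^ 2 / 2)) with hT
  set J : Config (N + 1) (Fin 3) T3 → ℝ := fun w => ∫ x,
    (empiricalEnergyField w (fun y => k (x - y)) + empiricalDensityField w (fun y => k (x - y)) *
        (2 / 3 * (empiricalEnergyField w (fun y => k (x - y)) / empiricalDensityField w (fun y => k (x - y)) -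
          ‖empiricalMomentumField w (fun y => k (x - y))‖ ^ 2 / (2 * empiricalDensityField w (fun y => k (x - y)) ^ 2)))) /
        empiricalDensityField w (fun y => k (x - y)) *
      (∑ i, empiricalMomentumField w (fun y => k (x - y)) i * Torus.partialDeriv i ψ x) with hJ
  have hWTi : Integrable (fun z => ∫ s in t₁..t₂, T (Φ.flow s z)) (localGibbsLaw σ a₀ u₀ θ₀ N Φ) :=
    integrable_window_flow_moment hσ ha hθ hu ha0 hθ0 Φ (measurable_currentObservable hkc hψ _)
      (fun w => abs_integral_currentIntegrand_le w hkc hk0 hk1 hC) t₁ t₂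
  have hWJi : Integrable (fun z => ∫ s in t₁..t₂, J (Φ.flow s z)) (localGibbsLaw σ a₀ u₀ θ₀ N Φ) :=
    integrable_window_flow_moment hσ ha hθ hu ha0 hθ0 Φ (measurable_idealCurrentObservable hkc hψ)
      (fun w => abs_integral_idealCurrentIntegrand_le w hkc hk0 hk1 hC) t₁ t₂
  have hD' : D = fun z => (∫ s in t₁..t₂, T (Φ.flow s z)) - ∫ s in t₁..t₂, J (Φ.flow s z) := hD
  rw [hD']
  exact hWTi.sub hWJi

end Summit.AtomisticToContinuum.HydrodynamicLimit.Theorems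

end
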